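import Summits.ResolutionOfSingularities.ResolutionOfSingularities.Theses.UniversalCells
import Summits.ResolutionOfSingularities.ResolutionOfSingularities.Theorems.HironakaBridge
import HarnessLib

/-!
# [OURS · L1 W8.2] PRIME-FIELD / FAMILY TRANSFER instead of descent (rung B) — campaign statements
# on the host route `UniversalCells`, crux `PrimeFieldToPerfect` (stmt-ResolutionOfSingularities-15233)

Cell `res-hironaka` (run/shared/lean/pub/res-hironaka/), LADDER-RESOLUTION rung L (RESCUE), slot W8.2 of
plan/RESCUE-SEED.md («PRIME-FIELD / UNIVERSALITY TRANSFER instead of descent: resolve over 𝔽_p or F̄_p and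
transfer FAMILIES»; doors `Theses.UniversalCells.PrimeFieldToPerfect` stmt-15233 and
`Theses.UniformComplexity.PrimeModelTransfer` stmt-8933). Statement-only file (typer res-L1-type-o6,
statement-only lane): every declaration is a `Prop` (OURS) or a pure-logic anchor (`Iff.rfl` / composition
of hypotheses); NOTHING is proved about resolution of singularities here and nothing is asserted.

HONEST FRAMING. Every `def` below is OURS — a campaign statement that REPLACES THE ROLE of a printed item of
H. Hironaka's manuscript *Resolution of singularities in positive characteristics* (2017-03-23,
[Hironaka2017], lit key `paper:url-3343fd9e678b`; PDF page = printed page, `l.` = line of the page text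
file) — namely §17 ¶2, p.89 l.59–62: «In this work the base field K is always assumed to be a finite field
or Z/pZ because our resolution is for all dimension. When the K has transcendence degree d we can
reformulate the resolution problem to the case of dimension d + dim Z.» (typed AS PRINTED, not asserted, as
`Literature.AlgebraicGeometry.Hironaka2017.S17Methodology.U89_2` / `U89_3` / `U89_3_ours`), read with the
standing convention §2 p.4 l.22–24 «a perfect base field K of characteristic p > 0. In particular we may
choose K = Z/pZ.» NOT a statement of the manuscript; nothing here is attributed to its author; the typed
candidates are not even used as hypotheses in this file. AI transcription, weaker than expert review.

WHAT THE SLOT REPLACES THE §17 ¶2 DEVICE BY (non-embedded summit idiom `Scheme.HasResolution`, integral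
separated schemes of finite type, ground field passed explicitly as `f : X ⟶ Spec K`):

* `PrimeToFg p` — HALF (a) of stmt-15233 at `p`: resolution over the PRIME field `ZMod p` ⇒ resolution over
  every field of characteristic `p` FINITELY GENERATED as a field. Mechanism = transfer of FAMILIES with a
  regular total space, not of fibres (spread out over a finitely generated `𝔽_p`-algebra, resolve the total
  space as an `𝔽_p`-scheme, pass to the generic fibre — no ground-field extension, so the transport
  barriers are not met). KERNEL-AVAILABLE in the tree, verbatim:
  `Theorems.PrimeFieldToPerfect.stub_spreadOut` (Theorems/UniversalCellsPrimeFieldToPerfectStubSpreadOut.lean);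
  same content, up to the reduced/integral bookkeeping (`Theorems.descentReducedToIntegral_proof`) and the
  subfield idiom `L = Subfield.closure ↑t ⊆ k`, as `Theorems.b1_holds : B1 p` (Theorems/HironakaBridgeLinks.lean).
* `FgToPerfect p` — HALF (b) of stmt-15233 at `p`: finitely generated fields ⇒ all PERFECT fields (reduced
  schemes). OPEN as a whole; its registered open kernel is `ClimbRatFuncPerf p`.
* `ClimbRatFuncPerf p` — the ONE-TRANSCENDENTAL PURELY INSEPARABLE CLIMB `M ↦ M(t)^{perf}` (perfect `M`):
  VERBATIM the registered open stub `stub_climbRatFuncPerf` of the crux skeleton of stmt-15233 (RESHAPE 4,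
  Cruxes/PrimeFieldToPerfect/Lines/birth.lean) and of line `shared-climb-kernel` of stmt-8933
  (Cruxes/PrimeModelTransfer/Lines/shared_climb_kernel.lean), universally closed over its parameters at `p`;
  the tree theorem `Theorems.PrimeFieldToPerfect.primeFieldToPerfect_of_climbRatFuncPerf`
  (Theorems/UniversalCellsPrimeFieldToPerfectOfClimbRatFuncPerf.lean) has hypothesis literally
  `∀ p, p.Prime → ClimbRatFuncPerf p` and conclusion `PrimeFieldToPerfect`. This is the slot's honest residual.
* `PrimeFieldTransferAt p` — the `p`-slice of the crux; `primeFieldToPerfect_iff` (by `Iff.rfl`) records that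
  `Theses.UniversalCells.PrimeFieldToPerfect` is the conjunction of the slices over primes, and
  `primeFieldTransferAt_of_primeToFg_of_fgToPerfect` (pure logic) that (a) ∧ (b) give the slice.

BARRIERS (catalogued files under `Literature/Barriers/ResolutionOfSingularities/`, decls in namespace
`Literature.Barriers.ResolutionOfSingularities`; why (a) evades them and where (b) meets them): file
`RegularNotGeometricallyRegular.lean` (regular ≠ geometrically regular under inseparable ground-field
extension), file `InseparableBaseChangeResolution.lean` decls `not_hasResolution_Spec_dualNumber` /
`not_hasResolution_pullback_extField` (resolve-then-base-change fails along inseparable extensions), file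
`FrobeniusTwistResolution.lean` decl `not_hasResolution_Spec_frobTwist`. Half (a) makes NO base change (generic
fibre of a resolved total space: tree `Summit.….Theorems.hasResolution_pullback_of_flat_of_surjectiveOnStalks`,
Theorems/DescentDescentPerfectToAllLevelResolution.lean, and
`Literature.AlgebraicGeometry.Resolution.hasResolution_Spec_of_essFiniteType`, ResolutionLocalization.lean);
half (b) must cross `K₀ ⊂ K₀^{perf}` and is where the barriers bite (negative lemmas landed under
Theorems/PrimeFieldToPerfect/Negative/SmoothTwistFalseWithoutGeomIntegral.lean, namespace
`Summit.….Theorems.PrimeFieldToPerfect.Negative`: `smoothTwist_false_without_geomIntegral`,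
`no_smoothModel_inseparablePoint`).

VACUITY SELF-CHECK (per decl, one line each in the docstrings): none of the four `Prop`s is trivially true or
false as typed — each hypothesis is implied by the summit statement (so not refutable short of it) and each
conclusion contains resolution of integral fourfolds over some field of characteristic `p` (open).

## References (vocabulary and locators only; nothing cited as a premise)
* H. Hironaka, ms. 2017-03-23, §17 ¶2 p.89 l.59–62; §2 p.4 l.22–24; §1 p.3 l.5–8 — under adjudication,
  quoted for the role replaced, not asserted. [Hironaka2017]
* A. Grothendieck, EGA IV₃, Thm. 8.8.2 (ii), 8.10.5 — spreading out (the mechanism of half (a); used by the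
  tree proofs named above, not here). [EGAIV3]
* plan/RESCUE-SEED.md row W8.2, plan/RUNG-B.md v0.2 §2 (B1), L/SLOTS.md §2 W8.2 — cell files, OURS.
-/

noncomputable section

set_option linter.dupNamespace false -- mandated namespace of this single-conjunct summit

open _root_.CategoryTheory _root_.AlgebraicGeometry
open Literature.AlgebraicGeometry.Resolution

namespace Summit.ResolutionOfSingularities.ResolutionOfSingularities.Theorems.CampaignW82

/-! ## Half (a): prime field ⇒ finitely generated fields (transfer of families) -/

/-- [OURS · L1 W8.2] replaces the role of §17 ¶2, p.89 l.59–62 («K … a finite field or Z/pZ … When the K has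
transcendence degree d we can reformulate the resolution problem to the case of dimension d + dim Z»; typed
as `S17Methodology.U89_2` / `U89_3`) for FINITELY GENERATED ground fields, in the non-embedded summit
idiom; NOT a statement of the manuscript.
HALF (a) of `Theses.UniversalCells.PrimeFieldToPerfect` (stmt-15233) at `p`: if every integral separated
scheme of finite type over `Spec (ZMod p)` has a resolution (`Scheme.HasResolution`: a proper birational
morphism from a regular scheme), then so does every integral separated scheme of finite type over every
field `K` of characteristic `p` that is finitely generated as a field (`Subfield.closure ↑s = ⊤` for a finite
`s : Finset K`). Binders copied from the landed stub `Theorems.PrimeFieldToPerfect.stub_spreadOut`, which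
proves exactly this for `p` prime (transfer of FAMILIES: resolve the total space of a model over a finitely
generated `𝔽_p`-algebra, take the generic fibre; no base change). Vacuity: not trivially true (the conclusion
contains resolution of integral fourfolds over `𝔽_p(t)`, open) nor trivially false (hypothesis and conclusion
are both consequences of the summit statement). [folklore] -/
def PrimeToFg (p : ℕ) : Prop :=
  (∀ (X : Scheme.{0}) (f : X ⟶ Spec (.of (ZMod p))),
      IsSeparated f → LocallyOfFiniteType f → QuasiCompact f → IsIntegral X → Scheme.HasResolution X) →
    ∀ (K : Type) [Field K] [CharP K p], (∃ s : Finset K, Subfield.closure (s : Set K) = ⊤) →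
      ∀ (X : Scheme.{0}) (f : X ⟶ Spec (.of K)),
        IsSeparated f → LocallyOfFiniteType f → QuasiCompact f → IsIntegral X → Scheme.HasResolution X

/-! ## Half (b): finitely generated fields ⇒ all perfect fields, and its registered kernel -/

/-- [OURS · L1 W8.2] replaces the role of §17 ¶2, p.89 l.60–62 read with §2 p.4 l.22–24 (typed as
`S17Methodology.U89_3_ours`: target field `K` PERFECT of transcendence degree `d`) for perfect ground fields
that are NOT finitely generated, in the non-embedded summit idiom; NOT a statement of the manuscript.
HALF (b) of `Theses.UniversalCells.PrimeFieldToPerfect` (stmt-15233) at `p`: if every integral separated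
scheme of finite type over every FINITELY GENERATED field of characteristic `p` has a resolution, then so
does every REDUCED separated scheme of finite type over every PERFECT field `k` of characteristic `p`
(the conclusion is verbatim the `p`-slice of the antecedent of `Theses.Descent.DescentPerfectToAll`,
stmt-0549, i.e. `Theorems.PerfectRes p` of Theorems/HironakaBridge.lean). OPEN as a whole: a resolution over
a finitely generated `K₀` base-changes to a regular, not necessarily geometrically regular, scheme over
`K₀^{perf}` (barrier file `Literature/Barriers/ResolutionOfSingularities/RegularNotGeometricallyRegular.lean`);
the tree reduces it to the kernel `ClimbRatFuncPerf` (below) via the landed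
`Theorems.PrimeFieldToPerfect.stub_tower`, `….stub_separableDescent`, `….stub_climbAlgebraic`,
`….climbTranscendental_of_climbRatFuncPerf` and `Theorems.descentReducedToIntegral_proof` (assembled in
`Theorems.PrimeFieldToPerfect.primeFieldToPerfect_of_climbRatFuncPerf`).
Vacuity: not trivially true (conclusion ⊇ resolution of fourfolds over `𝔽_p(t)^{perf}`, open) nor trivially
false (both sides follow from the summit statement). [folklore] -/
def FgToPerfect (p : ℕ) : Prop :=
  (∀ (K : Type) [Field K] [CharP K p], (∃ s : Finset K, Subfield.closure (s : Set K) = ⊤) →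
      ∀ (X : Scheme.{0}) (f : X ⟶ Spec (.of K)),
        IsSeparated f → LocallyOfFiniteType f → QuasiCompact f → IsIntegral X → Scheme.HasResolution X) →
    ∀ (k : Type) [Field k] [CharP k p] [PerfectField k] (X : Scheme.{0}) (f : X ⟶ Spec (.of k)),
      IsSeparated f → LocallyOfFiniteType f → QuasiCompact f → IsReduced X → Scheme.HasResolution X

/-- [OURS · L1 W8.2] replaces the role of §17 ¶2, p.89 l.60–62 («transcendence degree d … dimension
d + dim Z»; `S17Methodology.U89_3_ours`) ONE TRANSCENDENTAL AT A TIME over a PERFECT constant field, in the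
non-embedded summit idiom; NOT a statement of the manuscript.
THE CLIMB KERNEL at `p` — VERBATIM the registered open stub `stub_climbRatFuncPerf` (crux skeleton of
stmt-15233, RESHAPE 4; line `shared-climb-kernel` of stmt-8933), universally closed over its parameters:
for every PERFECT field `M` of characteristic `p` over which all integral separated schemes of finite type
have resolutions, all integral separated schemes of finite type over every PERFECT field `L` purely
inseparable over the rational function field `RatFunc M` (so `L ≅ M(t)^{perf}`) have resolutions. The tree
theorem `Theorems.PrimeFieldToPerfect.primeFieldToPerfect_of_climbRatFuncPerf` has hypothesis literally
`∀ p, p.Prime → ClimbRatFuncPerf p` and conclusion `Theses.UniversalCells.PrimeFieldToPerfect`; conversely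
`Theorems.PrimeFieldToPerfect.climbRatFuncPerf_of_resolutionOfSingularities` derives it from the summit
statement. This is slot W8.2's honest residual (where the transport barriers bite — files
`RegularNotGeometricallyRegular.lean`, `FrobeniusTwistResolution.lean` (decl
`Literature.Barriers.ResolutionOfSingularities.not_hasResolution_Spec_frobTwist`): every finite level
`M(t^{1/p^m}) ≅ RatFunc M` supplies only REGULAR models). Vacuity: not trivially true (the
conclusion contains resolution of integral schemes of dimension ≥ 4 over `𝔽_p(t)^{perf}`, open; dimension
≤ 3 would follow from the named fact `Literature.AlgebraicGeometry.Resolution.CossartPiltant2019`, not used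
here) nor trivially false (implied by the summit statement). [folklore] -/
def ClimbRatFuncPerf (p : ℕ) : Prop :=
  ∀ (M : Type) [Field M] [CharP M p] [PerfectField M],
    (∀ (X : Scheme.{0}) (f : X ⟶ Spec (.of M)),
        IsSeparated f → LocallyOfFiniteType f → QuasiCompact f → IsIntegral X → Scheme.HasResolution X) →
      ∀ (L : Type) [Field L] [PerfectField L] [Algebra (RatFunc M) L] [IsPurelyInseparable (RatFunc M) L]
        (X : Scheme.{0}) (f : X ⟶ Spec (.of L)),
        IsSeparated f → LocallyOfFiniteType f → QuasiCompact f → IsIntegral X → Scheme.HasResolution X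

/-! ## The `p`-slice of the crux and the pure-logic anchors -/

/-- [OURS · L1 W8.2] bookkeeping, replaces no printed item by itself: the `p`-slice of the crux
`Theses.UniversalCells.PrimeFieldToPerfect` (stmt-15233) — resolution of integral separated schemes of
finite type over `Spec (ZMod p)` ⇒ resolution of reduced separated schemes of finite type over every perfect
field of characteristic `p`; NOT a statement of the manuscript. `primeFieldToPerfect_iff` records by `Iff.rfl`
that the crux is `∀ p, p.Prime → PrimeFieldTransferAt p`. Vacuity: as for the crux (survived the refuter's
crux-attack 2026-08-17; implied by the summit statement). [folklore] -/
def PrimeFieldTransferAt (p : ℕ) : Prop :=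
  (∀ (X : Scheme.{0}) (f : X ⟶ Spec (.of (ZMod p))),
      IsSeparated f → LocallyOfFiniteType f → QuasiCompact f → IsIntegral X → Scheme.HasResolution X) →
    ∀ (k : Type) [Field k] [CharP k p] [PerfectField k] (X : Scheme.{0}) (f : X ⟶ Spec (.of k)),
      IsSeparated f → LocallyOfFiniteType f → QuasiCompact f → IsReduced X → Scheme.HasResolution X

/-- The crux `PrimeFieldToPerfect` (stmt-ResolutionOfSingularities-15233, `Theses/UniversalCells.lean`) is,
verbatim, the conjunction over primes of `PrimeFieldTransferAt p`. [folklore] -/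
theorem primeFieldToPerfect_iff :
    Summit.ResolutionOfSingularities.ResolutionOfSingularities.Theses.UniversalCells.PrimeFieldToPerfect ↔
      ∀ p : ℕ, p.Prime → PrimeFieldTransferAt p :=
  Iff.rfl

/-- **The split is pure logic**: half (a) and half (b) at `p` give the `p`-slice of the crux. [folklore] -/
theorem primeFieldTransferAt_of_primeToFg_of_fgToPerfect {p : ℕ} (ha : PrimeToFg p) (hb : FgToPerfect p) :
    PrimeFieldTransferAt p :=
  fun h0 => hb (fun K _ _ hK => ha h0 K hK)

/-- Hence `∀ p` of the two halves gives the crux itself (pure logic). [folklore] -/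
theorem primeFieldToPerfect_of_halves (ha : ∀ p : ℕ, p.Prime → PrimeToFg p)
    (hb : ∀ p : ℕ, p.Prime → FgToPerfect p) :
    Summit.ResolutionOfSingularities.ResolutionOfSingularities.Theses.UniversalCells.PrimeFieldToPerfect :=
  primeFieldToPerfect_iff.2 fun p hp => primeFieldTransferAt_of_primeToFg_of_fgToPerfect (ha p hp) (hb p hp)

/-- The conclusion of `PrimeFieldTransferAt p` is literally `Theorems.PerfectRes p` (Theorems/HironakaBridge.lean,
the `p`-slice of the antecedent of crux stmt-0549): the rung-B vocabulary and this slot's vocabulary agree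
(`Iff.rfl`). [folklore] -/
theorem primeFieldTransferAt_iff_perfectRes (p : ℕ) :
    PrimeFieldTransferAt p ↔
      ((∀ (X : Scheme.{0}) (f : X ⟶ Spec (.of (ZMod p))),
          IsSeparated f → LocallyOfFiniteType f → QuasiCompact f → IsIntegral X → Scheme.HasResolution X) →
        Summit.ResolutionOfSingularities.ResolutionOfSingularities.Theorems.PerfectRes p) :=
  Iff.rfl

end Summit.ResolutionOfSingularities.ResolutionOfSingularities.Theorems.CampaignW82

end
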